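import Summits.QuantumFields.YangMills.Theorems.BalabanUVNodesN15KingModelPotentialComplexLimitLetters

/-!
# N15 (NE2) King-model rung, PART 35 — CAUCHY ESTIMATES WITH DECAY: every order of the coupling expansion of the dressed covariances is
# exponentially local, carries NE2's η-rate, and converges geometrically to the continuum limit — uniformly in the cutoff

Eleventh generation (g11) of the seat `pub-ymgap-dag-n15-d`, part 35 (on 32 `…PotentialComplexLetters`, 33 `…PotentialComplexLimitLetters`).  Part 28b bounded
the Taylor coefficients `∂ⁿ_z C^{(k)}_z(x,y)∕n!` of the dressed covariance in the complex coupling — the `n`-th order kernels of the φ²-source perturbation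
series — by `(2∕γ₀)R^{−n}`, uniformly in `k` (Cauchy's estimate on the rate-free bound).  Parts 32–33 made the bound on the disc DECAY in `|x − y|`, carry the
two-spacing RATE, and control the distance to the LIMIT.  Cauchy's estimate (Mathlib `Complex.norm_iteratedDeriv_le_of_forall_mem_sphere_norm_le`) on a circle
inside that disc transfers each of these to every derivative:

* §1 ★★ `norm_iteratedDeriv_kingCovPotC_le_decay` (any unit torus, 9c's window) — **EVERY ORDER IS LOCAL**: for a circle `sphere z₀ ρ` inside the disc
  `‖z‖ < (r∕(1+r))·min(r_K∕w₀, 1)`, `‖∂ⁿ_z C^{(k)}_{z·v}(x,y)|_{z₀}‖ ≤ n!·(4∕γ₀)·e^{−(1−λ(r))κ′|x−y|}∕ρⁿ`, all `n`, uniformly in `k ≥ 1`, the volume, the potential;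
* §2 (King-admissible tori, 10e's window) ★★ `norm_iteratedDeriv_kingCovPotC_le_decay_kingU` (the same in the uniform window), ★★★
  `norm_iteratedDeriv_kingCov_twoSpacing_le` — **EVERY ORDER CARRIES THE η-RATE WITH DECAY**:
  `‖∂ⁿ_z (C^{(k+1)}_{z·v} − C^{(k)}_{z·v})(x,y)|_{z₀}‖ ≤ n!·C^{1−λ}M^{λ}ϑ^k·e^{−(1−λ)(κ∕2)|x−y|}∕ρⁿ` (`ϑ = θ^{1−λ(r)}`, `θ = L^{−1∕4}`), and ★★
  `norm_iteratedDeriv_kingCov_sub_lim_le` — **EVERY ORDER CONVERGES GEOMETRICALLY TO THE LIMIT'S**: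
  `‖∂ⁿ_z (C^{(k+1)}_{z·v} − C^{(∞)}_z)(x,y)|_{z₀}‖ ≤ n!·C^{1−λ}M^{λ}e^{−(1−λ)(κ∕2)|x−y|}·ϑ^{k+1}∕((1−ϑ)ρⁿ)`; ★ `norm_iteratedDeriv_kingCovLimC_le_decay` (the limit's
  own coefficients are local).

References (method): Cauchy's estimate [folklore] (Mathlib); two-constants theorem [Ransford1995, Thm. 4.3.7] via 32∕33 (tree's `TwoConstantsDisc` ∕
`B13RealSliceEntryLetters`, BY NAME); template [B9] Thm 3.4 p.400, (3.64)–(3.65) p.402; King (4.34), Lemma 4.5 (4.38) p.674, §4 pp.675–676.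

HONEST SCOPE.  King's A = 0 SCALAR model; real potential towers × one complex coupling; derivatives in the COUPLING `z` only (the `n`-th order response to the
scalar insertion `z·v`), not functional derivatives in a gauge field; NOT Bałaban's `U′U` ∕ `C^{(k)}(Λ;U)`; NOT a node discharge; count-neutral.  No `sorry`.
-/

noncomputable section

open scoped BigOperators Matrix
open Filter Topology Metric Finset Complex

namespace Summit.QuantumFields.YangMills.BalabanUVNodes.N15.KingModel

open Literature.MathematicalPhysics.QuantumFieldTheory.Balaban1983to89 hiding blockOf
open Literature.MathematicalPhysics.QuantumFieldTheory.Balaban1983to89.B5Prop11Plancherel (Tor fine)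
open Literature.MathematicalPhysics.QuantumFieldTheory.Balaban1983to89.B13RealSliceEntryLetters (lam lam_nonneg lam_lt_one)
open Literature.MathematicalPhysics.QuantumFieldTheory.King1986.Torus (gam0L gam0L_pos tdistT tdistT_isPseudoDist kapCT kapCT_pos_le)
open Summit.QuantumFields.YangMills.BalabanUVNodes.N15KingModelRung.Curved (underPtN)

variable {d : ℕ}

/-- A closed ball around `z₀` of radius `ρ` with `‖z₀‖ + ρ < R` lies in the open ball `‖z‖ < R`; so does the sphere. [folklore] -/
theorem closedBall_subset_ball_of_norm_add_lt {z₀ : ℂ} {ρ R : ℝ} (h : ‖z₀‖ + ρ < R) : closedBall z₀ ρ ⊆ ball (0 : ℂ) R := by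
  intro z hz
  rw [mem_ball_zero_iff]
  have h1 : ‖z - z₀‖ ≤ ρ := mem_closedBall_iff_norm.mp hz
  calc ‖z‖ = ‖z₀ + (z - z₀)‖ := by rw [add_sub_cancel]
    _ ≤ ‖z₀‖ + ‖z - z₀‖ := norm_add_le _ _
    _ ≤ ‖z₀‖ + ρ := by linarith
    _ < R := h

/-- **Cauchy's estimate with an arbitrary bound on the circle** (the form used below): `f` ℂ-differentiable on an open ball `B` containing the closed disc
`closedBall z₀ ρ` (`ρ > 0`) and `‖f z‖ ≤ K` on the circle `sphere z₀ ρ` ⇒ `‖f^{(n)}(z₀)‖ ≤ n!·K∕ρⁿ`. [folklore] -/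
theorem norm_iteratedDeriv_le_of_sphere {f : ℂ → ℂ} {z₀ : ℂ} {ρ R K : ℝ} (hρ : 0 < ρ) (hR : ‖z₀‖ + ρ < R)
    (hf : DifferentiableOn ℂ f (ball (0 : ℂ) R)) (hK : ∀ z ∈ sphere z₀ ρ, ‖f z‖ ≤ K) (n : ℕ) :
    ‖iteratedDeriv n f z₀‖ ≤ n.factorial * K / ρ ^ n := by
  have hdiff : DiffContOnCl ℂ f (ball z₀ ρ) := by
    refine DifferentiableOn.diffContOnCl ?_
    rw [closure_ball z₀ hρ.ne']
    exact hf.mono (closedBall_subset_ball_of_norm_add_lt hR)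
  exact Complex.norm_iteratedDeriv_le_of_forall_mem_sphere_norm_le n hρ hdiff hK

/-! ## §1 Every order of the coupling expansion is exponentially local (any unit torus) -/

section Locality

variable {a m2 : ℝ} {L : ℕ} [NeZero L] {M : Fin (d + 1) → ℕ} [∀ μ, NeZero (M μ)]

/-- ★★ **EVERY ORDER OF THE φ²-INSERTION SERIES IS EXPONENTIALLY LOCAL, UNIFORMLY IN THE CUTOFF.**  For `L ≥ 2`, `a, m² > 0`, `k ≥ 1`, a potential tower with
`sup|v_N| ≤ w₀`, `0 < w₀ ≤ w̄`, 9c's smallness `a²·ctCK²·kwSum·w₀ ≤ c̄`, every `0 < r < 1`, and every circle `sphere z₀ ρ` (`ρ > 0`) with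
`‖z₀‖ + ρ < (r∕(1+r))·min(r_K∕w₀, 1)`:  for every `n`,
`‖∂ⁿ_z C^{(k)}_{z·v}(x,y)|_{z = z₀}‖ ≤ n!·(4∕γ₀)·e^{−(1−λ(r))κ′|x−y|_T}∕ρⁿ` — Cauchy's estimate on 32's decaying disc bound (`kingCovPotC_apply_decay`).
[cite: Balaban1985BackgroundPropagators, Thm 3.4 p.400, (3.64)–(3.65) p.402 (template); King1986, (4.34) p.674 (A = 0); Ransford1995, Thm. 4.3.7] -/
theorem norm_iteratedDeriv_kingCovPotC_le_decay (ha : 0 < a) (hm : 0 < m2) (hL : 2 ≤ L) {k : ℕ} (hk : 1 ≤ k)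
    {v : ∀ N : ℕ, Tor (fine N (fine L M)) → ℝ} {w₀ : ℝ} (hw₀ : 0 < w₀) (hwb : w₀ ≤ wbarK (d + 1) a L) (hv : ∀ N x, |v N x| ≤ w₀)
    (hsmall : a ^ 2 * ctCK (d + 1) a L ^ 2 * kwSum (d + 1) a L * w₀ ≤ kingCbar (d + 1) a L)
    {r : ℝ} (hr0 : 0 < r) (hr1 : r < 1) {z₀ : ℂ} {ρ : ℝ} (hρ : 0 < ρ) (hzρ : ‖z₀‖ + ρ < r / (1 + r) * min (cplxWindow d a m2 L / w₀) 1)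
    (n : ℕ) (x y : Tor (fine L M)) :
    ‖iteratedDeriv n (fun z => kingCovPotC d a m2 L M k z (v (L ^ k)) x y) z₀‖
      ≤ n.factorial * (4 / gam0L (d + 1) a L * Real.exp (-((1 - lam r) * kapCT (d + 1) a L * tdistT (fine L M) x y))) / ρ ^ n := by
  have hwin := cplxWindow_pos (d := d) (a := a) (m2 := m2) (L := L) ha hm hL
  have hrad : r / (1 + r) * min (cplxWindow d a m2 L / w₀) 1 ≤ min (cplxWindow d a m2 L / w₀) 1 := by
    have h1 : r / (1 + r) ≤ 1 := (div_le_one (by linarith)).2 (by linarith)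
    have h2 : 0 ≤ min (cplxWindow d a m2 L / w₀) 1 := le_min (div_pos hwin hw₀).le zero_le_one
    calc r / (1 + r) * min (cplxWindow d a m2 L / w₀) 1 ≤ 1 * min (cplxWindow d a m2 L / w₀) 1 := mul_le_mul_of_nonneg_right h1 h2
      _ = _ := one_mul _
  refine norm_iteratedDeriv_le_of_sphere hρ hzρ ?_ (fun z hz => ?_) n
  · exact (differentiableOn_kingCovPotC_ball (d := d) ha hm hL hk hw₀ (hv _) x y).mono (ball_subset_ball hrad)
  · have hz' : ‖z‖ < r / (1 + r) * min (cplxWindow d a m2 L / w₀) 1 :=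
      mem_ball_zero_iff.1 (closedBall_subset_ball_of_norm_add_lt hzρ (sphere_subset_closedBall hz))
    exact kingCovPotC_apply_decay (M := M) ha hm hL hk hw₀ hwb hv hsmall hr0 hr1 hz' x y

end Locality

/-! ## §2 Every order carries the η-rate with decay and converges geometrically to the limit's (King-admissible tori) -/

section KingU

variable (L : ℕ) [NeZero L]

/-- ★★ **EVERY ORDER IS LOCAL, 10e's UNIFORM WINDOW** (King-admissible tori): for odd `L ≥ 3`, `a, m² > 0` there are `κ, w₁ > 0` such that for every volume
exponent, every tower of the window, every `k ≥ 1`, `0 < r < 1`, every circle `sphere z₀ ρ` with `‖z₀‖ + ρ < (r∕(1+r))·min(r_K∕w₀, 1)`, all `n` and all sites: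
`‖∂ⁿ_z C^{(k)}_{z·v}(x,y)|_{z₀}‖ ≤ n!·(4∕γ₀)·e^{−(1−λ(r))κ|x−y|_T}∕ρⁿ` (Cauchy on 33's `kingCovPotC_apply_decay_kingU`).
[cite: Balaban1985BackgroundPropagators, Thm 3.4 p.400 (template); King1986, (4.34) p.674 (A = 0); Ransford1995, Thm. 4.3.7] -/
theorem norm_iteratedDeriv_kingCovPotC_le_decay_kingU (hLodd : Odd L) (hL : 2 ≤ L) {a m2 : ℝ} (ha : 0 < a) (hm : 0 < m2) :
    ∃ κ w₁ : ℝ, 0 < κ ∧ 0 < w₁ ∧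
      ∀ (e : ℕ) (v : ∀ N : ℕ, Tor (fine N (kingU d L e)) → ℝ) (w₀ ν₀ s : ℝ),
      0 ≤ ν₀ → ν₀ ≤ w₁ → 0 ≤ s → s ≤ (L : ℝ) ^ (-(1 / 2 : ℝ)) →
      0 < w₀ → (∀ (N : ℕ) (x : Tor (fine N (kingU d L e))), |v N x| ≤ w₀) → w₀ ≤ w₁ →
      (∀ (k : ℕ), 1 ≤ k → ∀ x' : Tor (fine (L ^ 1 * L ^ k) (kingU d L e)),
          |v (L ^ 1 * L ^ k) x' - v (L ^ k) (underPtN L k 1 (kingU d L e) x')| ≤ ν₀ * s ^ k) →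
      ∀ (k : ℕ), 1 ≤ k → ∀ (r : ℝ), 0 < r → r < 1 → ∀ (z₀ : ℂ) (ρ : ℝ), 0 < ρ →
        ‖z₀‖ + ρ < r / (1 + r) * min (cplxWindow d a m2 L / w₀) 1 →
      ∀ (n : ℕ) (x y : Tor (kingU d L e)),
        ‖iteratedDeriv n (fun z => kingCovPotC d a m2 L (kingM d L e) k z (v (L ^ k)) x y) z₀‖
          ≤ n.factorial * (4 / gam0L (d + 1) a L * Real.exp (-((1 - lam r) * κ * tdistT (kingU d L e) x y))) / ρ ^ n := by
  obtain ⟨κ, w₁, hκ, hw₁, H⟩ := kingCovPotC_apply_decay_kingU (d := d) L hLodd hL ha hm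
  refine ⟨κ, w₁, hκ, hw₁, ?_⟩
  intro e v w₀ ν₀ s hν₀ hν₁ hs0 hs1 hw₀ hv hw₁' hcoh k hk r hr0 hr1 z₀ ρ hρ hzρ n x y
  have hwin := cplxWindow_pos (d := d) (a := a) (m2 := m2) (L := L) ha hm hL
  obtain ⟨hrad, -⟩ := disc_radius_le (d := d) (a := a) (m2 := m2) L hr0 hw₀ hwin
  refine norm_iteratedDeriv_le_of_sphere hρ hzρ ?_ (fun z hz => ?_) n
  · exact (differentiableOn_kingCovPotC_ball (d := d) ha hm hL hk hw₀ (hv _) x y).mono (ball_subset_ball hrad)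
  · have hz' : ‖z‖ < r / (1 + r) * min (cplxWindow d a m2 L / w₀) 1 :=
      mem_ball_zero_iff.1 (closedBall_subset_ball_of_norm_add_lt hzρ (sphere_subset_closedBall hz))
    exact H e v w₀ ν₀ s hν₀ hν₁ hs0 hs1 hw₀ hv hw₁' hcoh k hk r hr0 hr1 z hz' x y

/-- ★★★ **EVERY ORDER OF THE COUPLING EXPANSION CARRIES NE2's η-RATE, WITH DECAY.**  For odd `L ≥ 3`, `a, m² > 0` there are `κ, w₁, C > 0` such that
for every volume exponent, every tower of the window, every `k ≥ 1`, `0 < r < 1`, every circle `sphere z₀ ρ` with `‖z₀‖ + ρ < (r∕(1+r))·min(r_K∕w₀, 1)`,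
all `n` and all sites, with `θ = L^{−1∕4}`, `ϑ = θ^{1−λ(r)}`, `M = max(C, 4∕γ₀)`:
`‖∂ⁿ_z (C^{(k+1)}_{z·v}(x,y) − C^{(k)}_{z·v}(x,y))|_{z₀}‖ ≤ n!·C^{1−λ(r)}·M^{λ(r)}·ϑ^k·e^{−(1−λ(r))(κ∕2)|x−y|_T}∕ρⁿ` — the `n`-th Taylor coefficient of the
two-spacing difference (the `n`-th order φ²-insertion kernel's two-spacing difference) decays GEOMETRICALLY in `k` and exponentially in `|x − y|` (Cauchy on 32's
`kingCov_twoSpacing_complexRate_geometric`). [cite: King1986, Lemma 4.5 (4.38) p.674 (A = 0 template); Balaban1985BackgroundPropagators, Thm 3.4 p.400; Ransford1995, Thm. 4.3.7] -/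
theorem norm_iteratedDeriv_kingCov_twoSpacing_le (hLodd : Odd L) (hL : 2 ≤ L) {a m2 : ℝ} (ha : 0 < a) (hm : 0 < m2) :
    ∃ κ w₁ C : ℝ, 0 < κ ∧ 0 < w₁ ∧ 0 < C ∧
      ∀ (e : ℕ) (v : ∀ N : ℕ, Tor (fine N (kingU d L e)) → ℝ) (w₀ ν₀ s : ℝ),
      0 ≤ ν₀ → ν₀ ≤ w₁ → 0 ≤ s → s ≤ (L : ℝ) ^ (-(1 / 2 : ℝ)) →
      0 < w₀ → (∀ (N : ℕ) (x : Tor (fine N (kingU d L e))), |v N x| ≤ w₀) → w₀ ≤ w₁ →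
      (∀ (k : ℕ), 1 ≤ k → ∀ x' : Tor (fine (L ^ 1 * L ^ k) (kingU d L e)),
          |v (L ^ 1 * L ^ k) x' - v (L ^ k) (underPtN L k 1 (kingU d L e) x')| ≤ ν₀ * s ^ k) →
      ∀ (x y : Tor (kingU d L e)) (k : ℕ), 1 ≤ k → ∀ (r : ℝ), 0 < r → r < 1 → ∀ (z₀ : ℂ) (ρ : ℝ), 0 < ρ →
        ‖z₀‖ + ρ < r / (1 + r) * min (cplxWindow d a m2 L / w₀) 1 → ∀ n : ℕ,
        ‖iteratedDeriv n (fun z => kingCovPotC d a m2 L (kingM d L e) (k + 1) z (v (L ^ (k + 1))) x y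
            - kingCovPotC d a m2 L (kingM d L e) k z (v (L ^ k)) x y) z₀‖
          ≤ n.factorial * (C ^ (1 - lam r) * (max C (4 / gam0L (d + 1) a L)) ^ lam r * ((((L : ℝ) ^ (-(1 / 4 : ℝ))) ^ (1 - lam r)) ^ k)
              * Real.exp (-((1 - lam r) * (κ / 2) * tdistT (kingU d L e) x y))) / ρ ^ n := by
  obtain ⟨κ, w₁, C, hκ, hw₁, hC, H⟩ := kingCov_twoSpacing_complexRate_geometric (d := d) L hLodd hL ha hm
  refine ⟨κ, w₁, C, hκ, hw₁, hC, ?_⟩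
  intro e v w₀ ν₀ s hν₀ hν₁ hs0 hs1 hw₀ hv hw₁' hcoh x y k hk r hr0 hr1 z₀ ρ hρ hzρ n
  have hwin := cplxWindow_pos (d := d) (a := a) (m2 := m2) (L := L) ha hm hL
  obtain ⟨hrad, -⟩ := disc_radius_le (d := d) (a := a) (m2 := m2) L hr0 hw₀ hwin
  have hk1 : 1 ≤ k + 1 := Nat.succ_le_succ (Nat.zero_le k)
  refine norm_iteratedDeriv_le_of_sphere hρ hzρ ?_ (fun z hz => ?_) n
  · exact ((differentiableOn_kingCovPotC_ball (d := d) ha hm hL hk1 hw₀ (hv _) x y).sub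
      (differentiableOn_kingCovPotC_ball (d := d) ha hm hL hk hw₀ (hv _) x y)).mono (ball_subset_ball hrad)
  · have hz' : ‖z‖ < r / (1 + r) * min (cplxWindow d a m2 L / w₀) 1 :=
      mem_ball_zero_iff.1 (closedBall_subset_ball_of_norm_add_lt hzρ (sphere_subset_closedBall hz))
    exact H e v w₀ ν₀ s hν₀ hν₁ hs0 hs1 hw₀ hv hw₁' hcoh x y k hk r hr0 hr1 z hz'

/-- ★★ **EVERY ORDER CONVERGES GEOMETRICALLY TO THE CONTINUUM LIMIT'S, WITH DECAY**, and ★ **THE LIMIT'S COEFFICIENTS ARE LOCAL.**  For odd `L ≥ 3`,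
`a, m² > 0` there are `κ₁, κ₂, w₁, C > 0` such that for every volume exponent, every tower of the window, every `0 < r < 1`, every circle `sphere z₀ ρ`
with `‖z₀‖ + ρ < (r∕(1+r))·min(r_K∕w₀, 1)`, all sites, all `n`, with `ϑ = θ^{1−λ(r)}`, `M = max(C, 4∕γ₀)`:
(i) `‖∂ⁿ_z C^{(∞)}_z(x,y)|_{z₀}‖ ≤ n!·(4∕γ₀)·e^{−(1−λ(r))κ₁|x−y|_T}∕ρⁿ`;
(ii) `‖∂ⁿ_z (C^{(k+1)}_{z·v}(x,y) − C^{(∞)}_z(x,y))|_{z₀}‖ ≤ n!·C^{1−λ}·M^{λ}·e^{−(1−λ)(κ₂∕2)|x−y|_T}·ϑ^{k+1}∕((1−ϑ)·ρⁿ)` for every `k`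
(Cauchy on 33's `kingModel_complexCoupling_package`, items (a), (c), (e)).
[cite: King1986, §4 pp.675–676, Lemma 4.5 (4.38) p.674 (A = 0 template); Balaban1985BackgroundPropagators, Thm 3.4 p.400; Ransford1995, Thm. 4.3.7] -/
theorem norm_iteratedDeriv_kingCov_sub_lim_le (hLodd : Odd L) (hL : 2 ≤ L) {a m2 : ℝ} (ha : 0 < a) (hm : 0 < m2) :
    ∃ κ₁ κ₂ w₁ C : ℝ, 0 < κ₁ ∧ 0 < κ₂ ∧ 0 < w₁ ∧ 0 < C ∧
      ∀ (e : ℕ) (v : ∀ N : ℕ, Tor (fine N (kingU d L e)) → ℝ) (w₀ ν₀ s : ℝ),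
      0 ≤ ν₀ → ν₀ ≤ w₁ → 0 ≤ s → s ≤ (L : ℝ) ^ (-(1 / 2 : ℝ)) →
      0 < w₀ → (∀ (N : ℕ) (x : Tor (fine N (kingU d L e))), |v N x| ≤ w₀) → w₀ ≤ w₁ →
      (∀ (k : ℕ), 1 ≤ k → ∀ x' : Tor (fine (L ^ 1 * L ^ k) (kingU d L e)),
          |v (L ^ 1 * L ^ k) x' - v (L ^ k) (underPtN L k 1 (kingU d L e) x')| ≤ ν₀ * s ^ k) →
      ∀ (r : ℝ), 0 < r → r < 1 → ∀ (z₀ : ℂ) (ρ : ℝ), 0 < ρ → ‖z₀‖ + ρ < r / (1 + r) * min (cplxWindow d a m2 L / w₀) 1 →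
      ∀ (x y : Tor (kingU d L e)) (n : ℕ),
        ‖iteratedDeriv n (fun z => kingCovLimC a m2 L (kingM d L e) v z x y) z₀‖
            ≤ n.factorial * (4 / gam0L (d + 1) a L * Real.exp (-((1 - lam r) * κ₁ * tdistT (kingU d L e) x y))) / ρ ^ n ∧
        ∀ k : ℕ,
          ‖iteratedDeriv n (fun z => kingCovPotC d a m2 L (kingM d L e) (k + 1) z (v (L ^ (k + 1))) x y - kingCovLimC a m2 L (kingM d L e) v z x y) z₀‖
            ≤ n.factorial * (C ^ (1 - lam r) * (max C (4 / gam0L (d + 1) a L)) ^ lam r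
                * Real.exp (-((1 - lam r) * (κ₂ / 2) * tdistT (kingU d L e) x y))
                * ((((L : ℝ) ^ (-(1 / 4 : ℝ))) ^ (1 - lam r)) ^ (k + 1)) / (1 - ((L : ℝ) ^ (-(1 / 4 : ℝ))) ^ (1 - lam r))) / ρ ^ n := by
  obtain ⟨κ₁, κ₂, w₁, C, hκ₁, hκ₂, hw₁, hC, H⟩ := kingModel_complexCoupling_package (d := d) L hLodd hL ha hm
  refine ⟨κ₁, κ₂, w₁, C, hκ₁, hκ₂, hw₁, hC, ?_⟩
  intro e v w₀ ν₀ s hν₀ hν₁ hs0 hs1 hw₀ hv hw₁' hcoh r hr0 hr1 z₀ ρ hρ hzρ x y n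
  -- the package at the centre gives holomorphy on the whole disc; at the points of the circle it gives the bounds
  have HP := fun z (hz : ‖z‖ < r / (1 + r) * min (cplxWindow d a m2 L / w₀) 1) =>
    H e v w₀ ν₀ s hν₀ hν₁ hs0 hs1 hw₀ hv hw₁' hcoh r hr0 hr1 z hz x y
  have hz₀ : ‖z₀‖ < r / (1 + r) * min (cplxWindow d a m2 L / w₀) 1 := by linarith [norm_nonneg z₀]
  obtain ⟨hholk, hhollim, -, -, -, -, -, -, -⟩ := HP z₀ hz₀
  have hsph : ∀ z ∈ sphere z₀ ρ, ‖z‖ < r / (1 + r) * min (cplxWindow d a m2 L / w₀) 1 := fun z hz =>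
    mem_ball_zero_iff.1 (closedBall_subset_ball_of_norm_add_lt hzρ (sphere_subset_closedBall hz))
  refine ⟨norm_iteratedDeriv_le_of_sphere hρ hzρ hhollim (fun z hz => ?_) n, fun k => ?_⟩
  · obtain ⟨-, -, -, -, -, hlimdec, -, -, -⟩ := HP z (hsph z hz)
    exact hlimdec
  · refine norm_iteratedDeriv_le_of_sphere hρ hzρ ((hholk (k + 1) (Nat.succ_le_succ (Nat.zero_le k))).sub hhollim) (fun z hz => ?_) n
    obtain ⟨-, -, -, -, -, -, -, happ, -⟩ := HP z (hsph z hz)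
    exact happ k

end KingU

end Summit.QuantumFields.YangMills.BalabanUVNodes.N15.KingModel

end
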